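import Summits.ResolutionOfSingularities.ResolutionOfSingularities.Theorems.RadicialJungCleanModelsSufficeChartsKummer
import Summits.ResolutionOfSingularities.ResolutionOfSingularities.Theorems.RadicialJungCleanModelsSufficeRegularTypeSop
import Literature.AlgebraicGeometry.Resolution.LogRegularScheme

/-!
# Route `RadicialJung`, crux `CleanModelsSuffice`, line `Sketch`: Case A of the Kato charts at
# the level of the local ring

Helper for the registered stub `stub_charts` of the skeleton of
`Summit.ResolutionOfSingularities.ResolutionOfSingularities.Theses.RadicialJung.CleanModelsSuffice`
(stmt-ResolutionOfSingularities-15883). At a point `w` of the adapted clean model met by a CHARGED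
boundary component of a toroidal chart (Case A), the local algebra handed to `stub_charts` as
hypotheses — the structure of the Kummer order `R = A[z_0, …, z_{p-1}]` (`hStruct`), its Kato
regularity for the chart `Q_a` (`hLogReg`), and the unfolded Theorem (4.1) of Kato's 1994 paper
(`hK4`: log regular local rings are normal) — combine with the jointly-regular boundary parameters (JOINTSOP) as follows
(`isLogRegularLocal_kummerChartIntegral`): `R` is local, finite over `A = 𝒪_{V,w}`, with fraction
field `L`, and log regular, hence an integrally closed domain by (4.1), hence EQUAL to
`integralClosure A L`; so `integralClosure A L` is local and the Kummer chart into it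
(`kummerChartIntegral`) is log regular. The three hypotheses are taken unfolded, verbatim the
binders of `stub_charts`.
Also here: two facts on regular systems of parameters used by the assembly — distinct members
of a minimal system of generators of `𝔪` are not associated, and the sub-family of the `t_i`
lying in `𝔪`, when jointly part of a regular system, cuts out a regular quotient of the
complementary dimension (from `isRegularLocalRing_quotient_span_range_comp`).
-/

noncomputable section

set_option linter.dupNamespace false -- mandated namespace of this single-conjunct summit

open Literature.AlgebraicGeometry.Resolution IsLocalRing

namespace Summit.ResolutionOfSingularities.ResolutionOfSingularities.Theorems.RadicialJung.CleanModelsSuffice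

/-! ## Regular systems of parameters -/

/-- **Distinct members of a minimal system of generators of `𝔪` are not associated** (in a
regular local ring of dimension `d` with `𝔪 = (t₁, …, t_d)`): otherwise `𝔪` would be generated by
`d - 1` elements. [folklore] -/
theorem not_associated_of_ne {O : Type*} [CommRing O] [IsRegularLocalRing O] (d : ℕ)
    (tw : Fin d → O) (hspan : Ideal.span (Set.range tw) = maximalIdeal O)
    (hdim : ringKrullDim O = (d : WithBot ℕ∞)) {α β : Fin d} (hne : α ≠ β) :
    ¬ Associated (tw α) (tw β) := by
  classical
  rintro ⟨u, hu⟩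
  set T : Finset O := (Finset.univ.erase β).image tw with hT_def
  have hT : Ideal.span (T : Set O) = maximalIdeal O := by
    apply le_antisymm
    · rw [← hspan]
      refine Ideal.span_mono ?_
      intro x hx
      rw [hT_def, Finset.coe_image] at hx
      obtain ⟨i, -, rfl⟩ := hx
      exact ⟨i, rfl⟩
    · rw [← hspan, Ideal.span_le]
      rintro _ ⟨i, rfl⟩
      by_cases hi : i = β
      · subst hi
        rw [← hu]
        refine Ideal.mul_mem_right _ _ (Ideal.subset_span ?_)
        rw [hT_def, Finset.coe_image]
        exact ⟨α, by simp [hne], rfl⟩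
      · refine Ideal.subset_span ?_
        rw [hT_def, Finset.coe_image]
        exact ⟨i, by simp [hi], rfl⟩
  have h1 := Submodule.spanFinrank_span_le_ncard_of_finite (R := O) T.finite_toSet
  rw [Set.ncard_coe_finset] at h1
  have hT' : Submodule.span O (T : Set O) = maximalIdeal O := hT
  rw [hT'] at h1
  have h2 : T.card ≤ d - 1 := Finset.card_image_le.trans (by
    rw [Finset.card_erase_of_mem (Finset.mem_univ _), Finset.card_univ, Fintype.card_fin])
  have h3 : (maximalIdeal O).spanFinrank = d := by
    have h := IsRegularLocalRing.spanFinrank_maximalIdeal (R := O)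
    rw [hdim] at h
    exact_mod_cast h
  have hd : 0 < d := Fin.pos α
  omega

/-- **The `t_i` lying in `𝔪`, when jointly part of a minimal system of generators of `𝔪`, cut
out a regular local ring of the complementary dimension.** If `(O, 𝔪)` is regular of dimension
`dw` with `𝔪 = (tw₁, …, tw_{dw})` and `ι` assigns to each `i` with `t_i ∈ 𝔪` an index with
`tw_{ι i} = t_i`, injectively, then `O/(t_i : t_i ∈ 𝔪)` is regular and
`dim O/(t_S) + |S| = dim O` for `S = {i | t_i ∈ 𝔪}`. [cite: Matsumura1987, Thm. 14.2] -/
theorem isRegularLocalRing_quotient_span_image {O : Type*} [CommRing O] [IsRegularLocalRing O]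
    {n : ℕ} (t : Fin n → O) (S : Finset (Fin n)) (hS : ∀ i, i ∈ S ↔ t i ∈ maximalIdeal O)
    (dw : ℕ) (tw : Fin dw → O) (ι : Fin n → Fin dw)
    (hspan : Ideal.span (Set.range tw) = maximalIdeal O)
    (hdim : ringKrullDim O = (dw : WithBot ℕ∞))
    (htw : ∀ i, t i ∈ maximalIdeal O → tw (ι i) = t i)
    (hinj : ∀ i j, t i ∈ maximalIdeal O → t j ∈ maximalIdeal O → ι i = ι j → i = j) :
    IsRegularLocalRing (O ⧸ Ideal.span (t '' (S : Set (Fin n)))) ∧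
      ringKrullDim (O ⧸ Ideal.span (t '' (S : Set (Fin n)))) + (S.card : WithBot ℕ∞) =
        ringKrullDim O := by
  classical
  -- enumerate `S`
  let enum : Fin S.card → Fin n := fun j => (S.orderIsoOfFin rfl j : Fin n)
  have henum_mem : ∀ j, enum j ∈ S := fun j => (S.orderIsoOfFin rfl j).2
  have henum_surj : ∀ i ∈ S, ∃ j, enum j = i := fun i hi =>
    ⟨(S.orderIsoOfFin rfl).symm ⟨i, hi⟩, by
      change (((S.orderIsoOfFin rfl) ((S.orderIsoOfFin rfl).symm ⟨i, hi⟩) : S) : Fin n) = i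
      rw [OrderIso.apply_symm_apply]⟩
  let ι' : Fin S.card → Fin dw := ι ∘ enum
  have hι' : Function.Injective ι' := by
    intro j j' h
    have hm := fun j => (hS _).mp (henum_mem j)
    have h1 : enum j = enum j' := hinj _ _ (hm j) (hm j') h
    exact (S.orderIsoOfFin rfl).injective (Subtype.ext h1)
  have hrange : Set.range (tw ∘ ι') = t '' (S : Set (Fin n)) := by
    ext x
    constructor
    · rintro ⟨j, rfl⟩
      exact ⟨enum j, henum_mem j, (htw _ ((hS _).mp (henum_mem j))).symm⟩
    · rintro ⟨i, hi, rfl⟩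
      obtain ⟨j, rfl⟩ := henum_surj i hi
      exact ⟨j, htw _ ((hS _).mp (henum_mem j))⟩
  obtain ⟨hreg, hdim'⟩ := isRegularLocalRing_quotient_span_range_comp dw tw hspan hdim S.card ι' hι'
  rw [hrange] at hreg hdim'
  exact ⟨hreg, hdim'⟩

/-! ## Case A: the integral closure is local and the Kummer chart into it is log regular -/

/-- **Case A of the Kato charts, ring level.** Let `A` be a regular local ring with fraction
field `K` of characteristic `p`, `L/K` of degree `p`, `(t, a, y)` normalised Kummer data
(`a₀ = 1`, `1 ≤ a_i < p`, `y ∉ K`, `y^p = ∏ t_i^{a_i}`, `t_i ≠ 0`) such that SOME `t_i` lies in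
`𝔪_A` and those that do are jointly part of a minimal system of generators of `𝔪_A`. Assume the
three hypotheses `hK4`, `hStruct`, `hLogReg` of `stub_charts`. Then `integralClosure A L` is a
local ring and the Kummer chart `P_a → integralClosure A L` is log regular in Kato's sense: the
Kummer order `A[z_j]` is local and finite with fraction field `L` (`hStruct`), log regular
(`hLogReg`), hence normal (`hK4`), hence equal to `integralClosure A L`. [folklore] -/
theorem isLogRegularLocal_kummerChartIntegral
    (hK4 : ∀ (R : Type) [CommRing R] [IsNoetherianRing R] [IsLocalRing R] (n : ℕ)
      (P : AddSubmonoid (Fin n → ℤ)) (φ : Multiplicative P →* R),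
      P.FG → P.NSMulSaturated → Submodule.span ℤ (P : Set (Fin n → ℤ)) = ⊤ →
      LogChart.IsLogRegularLocal P φ → IsDomain R ∧ IsIntegrallyClosed R)
    (hStruct : ∀ {A K L : Type} [CommRing A] [IsRegularLocalRing A] [Field K]
      [Algebra A K] [IsFractionRing A K] [Field L] [Algebra K L] [Algebra A L] [IsScalarTower A K L]
      (p : ℕ) (_ : p.Prime) [CharP K p] (_ : Module.finrank K L = p) (m : ℕ)
      (t : Fin (m + 1) → A) (_ : ∀ i, t i ≠ 0) (a : Fin (m + 1) → ℕ) (_ : a 0 = 1)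
      (_ : ∀ i, 1 ≤ a i ∧ a i < p) (y : L) (_ : y ∉ Set.range (algebraMap K L))
      (_ : y ^ p = algebraMap A L (∏ i, t i ^ a i)) (z : Fin p → L)
      (_ : ∀ j, z j = y ^ (j : ℕ) / algebraMap A L (∏ i, t i ^ ((j : ℕ) * a i / p))),
      Subalgebra.toSubmodule (Algebra.adjoin A (Set.range z)) = Submodule.span A (Set.range z) ∧
      LinearIndependent A z ∧ Module.Finite A (Algebra.adjoin A (Set.range z)) ∧
      IsLocalRing (Algebra.adjoin A (Set.range z)) ∧
      IsFractionRing (Algebra.adjoin A (Set.range z)) L)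
    (hLogReg : ∀ {A K L : Type} [CommRing A] [IsRegularLocalRing A] [Field K]
      [Algebra A K] [IsFractionRing A K] [Field L] [Algebra K L] [Algebra A L] [IsScalarTower A K L]
      (p : ℕ) (_ : p.Prime) [CharP K p] (_ : Module.finrank K L = p) (m : ℕ)
      (t : Fin (m + 1) → A) (_ : ∀ i, t i ≠ 0) (a : Fin (m + 1) → ℕ) (_ : a 0 = 1)
      (_ : ∀ i, 1 ≤ a i ∧ a i < p) (y : L) (_ : y ∉ Set.range (algebraMap K L))
      (_ : y ^ p = algebraMap A L (∏ i, t i ^ a i))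
      (S : Finset (Fin (m + 1))) (_ : ∀ i, i ∈ S ↔ t i ∈ IsLocalRing.maximalIdeal A)
      (_ : S.Nonempty)
      (_ : IsRegularLocalRing (A ⧸ Ideal.span (t '' (S : Set (Fin (m + 1))))))
      (_ : ringKrullDim (A ⧸ Ideal.span (t '' (S : Set (Fin (m + 1))))) + (S.card : WithBot ℕ∞) =
        ringKrullDim A)
      (P : AddSubmonoid (Fin (m + 1) → ℤ))
      (_ : ∀ c : Fin (m + 1) → ℤ, c ∈ P ↔
        0 ≤ c 0 ∧ ∀ i : Fin (m + 1), i ≠ 0 → 0 ≤ (a i : ℤ) * c 0 + (p : ℤ) * c i)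
      (φ : Multiplicative P →*
        Algebra.adjoin A (Set.range fun j : Fin p =>
          y ^ (j : ℕ) / algebraMap A L (∏ i, t i ^ ((j : ℕ) * a i / p))))
      (_ : ∀ c : P, ((φ (Multiplicative.ofAdd c) : Algebra.adjoin A (Set.range fun j : Fin p =>
          y ^ (j : ℕ) / algebraMap A L (∏ i, t i ^ ((j : ℕ) * a i / p)))) : L) =
        y ^ ((c : Fin (m + 1) → ℤ) 0) *
          ∏ i ∈ Finset.univ.erase 0, algebraMap A L (t i) ^ ((c : Fin (m + 1) → ℤ) i)),
      LogChart.IsLogRegularLocal P φ)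
    {A K L : Type} [CommRing A] [IsRegularLocalRing A] [Field K]
    [Algebra A K] [IsFractionRing A K] [Field L] [Algebra K L] [Algebra A L] [IsScalarTower A K L]
    (p : ℕ) (hp : p.Prime) [CharP K p] (hdeg : Module.finrank K L = p) (m : ℕ)
    (t : Fin (m + 1) → A) (ht : ∀ i, t i ≠ 0) (ht' : ∀ i, algebraMap A L (t i) ≠ 0)
    (a : Fin (m + 1) → ℕ) (ha0 : a 0 = 1)
    (ha : ∀ i, 1 ≤ a i ∧ a i < p) (y : L) (hy : y ∉ Set.range (algebraMap K L)) (hy0 : y ≠ 0)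
    (hyp : y ^ p = algebraMap A L (∏ i, t i ^ a i))
    (hSne : ∃ i, t i ∈ maximalIdeal A)
    (hsop : ∃ (dw : ℕ) (tw : Fin dw → A) (ι : Fin (m + 1) → Fin dw),
      Ideal.span (Set.range tw) = maximalIdeal A ∧ ringKrullDim A = (dw : WithBot ℕ∞) ∧
      (∀ i, t i ∈ maximalIdeal A → tw (ι i) = t i) ∧
      (∀ i j, t i ∈ maximalIdeal A → t j ∈ maximalIdeal A → ι i = ι j → i = j)) :
    IsLocalRing (integralClosure A L) ∧
      LogChart.IsLogRegularLocal (kummerMonoid p a) (kummerChartIntegral p a y t hp.pos hy0 ht' hyp) := by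
  classical
  haveI : CharP L p := charP_of_injective_algebraMap (algebraMap K L).injective p
  -- the non-unit indices
  set S : Finset (Fin (m + 1)) := Finset.univ.filter fun i => t i ∈ maximalIdeal A with hS_def
  have hS : ∀ i, i ∈ S ↔ t i ∈ maximalIdeal A := fun i => by simp [hS_def]
  have hSne' : S.Nonempty := by
    obtain ⟨i, hi⟩ := hSne
    exact ⟨i, (hS i).mpr hi⟩
  -- regularity of `A/(t_S)` with the dimension count
  obtain ⟨dw, tw, ι, hspan, hdimA, htw, hinj⟩ := hsop
  obtain ⟨hreg, hdim⟩ :=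
    isRegularLocalRing_quotient_span_image t S hS dw tw ι hspan hdimA htw hinj
  -- the Kummer order and the chart into it
  let z : Fin p → L := fun j => y ^ (j : ℕ) / algebraMap A L (∏ i, t i ^ ((j : ℕ) * a i / p))
  let φR := kummerChartAdjoin p a y t hp hy0 ht' hyp z (fun _ => rfl)
  have hφR : ∀ c : kummerMonoid p a, ((φR (Multiplicative.ofAdd c) : Algebra.adjoin A
      (Set.range z)) : L) = y ^ ((c : Fin (m + 1) → ℤ) 0) *
        ∏ i ∈ Finset.univ.erase 0, algebraMap A L (t i) ^ ((c : Fin (m + 1) → ℤ) i) :=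
    fun _ => rfl
  have hLR : LogChart.IsLogRegularLocal (kummerMonoid p a) φR :=
    hLogReg p hp hdeg m t ht a ha0 ha y hy hyp S hS hSne' hreg hdim (kummerMonoid p a)
      (mem_kummerMonoid_iff p a) φR hφR
  obtain ⟨-, -, hfin, hloc, hfrac⟩ := hStruct p hp hdeg m t ht a ha0 ha y hy hyp z (fun _ => rfl)
  haveI := hfin
  haveI := hloc
  haveI := hfrac
  haveI : IsNoetherianRing (Algebra.adjoin A (Set.range z)) :=
    Algebra.FiniteType.isNoetherianRing A _
  obtain ⟨fg, sat, span⟩ := kummerMonoid_fs p hp.pos a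
  obtain ⟨-, hIC⟩ := hK4 (Algebra.adjoin A (Set.range z)) (m + 1) (kummerMonoid p a) φR fg sat span hLR
  -- `A[z_j] = integralClosure A L`
  have heq : Algebra.adjoin A (Set.range z) = integralClosure A L := by
    apply le_antisymm
    · intro x hx
      have h1 : IsIntegral A (⟨x, hx⟩ : Algebra.adjoin A (Set.range z)) :=
        Algebra.IsIntegral.isIntegral _
      exact h1.map (Algebra.adjoin A (Set.range z)).val
    · intro x hx
      have h1 : IsIntegral (Algebra.adjoin A (Set.range z)) x := IsIntegral.tower_top hx
      obtain ⟨r, hr⟩ := (isIntegrallyClosed_iff L).mp hIC h1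
      rw [← hr]
      exact r.2
  let e : Algebra.adjoin A (Set.range z) ≃ₐ[A] integralClosure A L :=
    Subalgebra.equivOfEq _ _ heq
  refine ⟨e.toRingEquiv.isLocalRing, ?_⟩
  have hcomp : e.toRingEquiv.toMonoidHom.comp φR = kummerChartIntegral p a y t hp.pos hy0 ht' hyp :=
    MonoidHom.ext fun c => Subtype.ext rfl
  rw [← hcomp]
  exact (LogChart.isLogRegularLocal_comp_equiv _ _ _).mpr hLR

end Summit.ResolutionOfSingularities.ResolutionOfSingularities.Theorems.RadicialJung.CleanModelsSuffice

end
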